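import Summits.BirchSwinnertonDyer.BirchSwinnertonDyer.Theorems.GenusKolyvaginAtTwoEquivariantKolyvaginExactAtTwoDualityRat
import HarnessLib

/-!
# Route ByReductionTypeAtTwo, crux `RankOneAtTwoBigImageOddLocal` (stmt-BirchSwinnertonDyer-23715), LINE v8.8 `one_door_analytic`:
# the ONE-LINE LEAF `hline` of the bottom rung — at a place with `#E(K_v)[2] = 2` the Kummer image is a single non-zero class

Width prover seat `bsd-line-fkl-p2` g10 (2026-08-28), `--supports stmt-BirchSwinnertonDyer-23715` (helper).  THEOREMS ONLY (no
definition, no named fact, no `sorry`).  BSD is not proved by any of this.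

The lead's kernel engine of Kolyvagin's first `2`-descent over `ℚ` (`Theorems/…OneDoorFirstDescentAtTwo.lean`, p637958; lead report
G11 §2) takes, at the error place `q₀` of a minimal door, the ONE-LINE input (Mazur–Rubin 2010 Lemma 2.2 (i): `dim H¹_f(ℚ_{q₀}, E[2]) =
dim E(ℚ_{q₀})[2] = 1` at a transposition prime)

    hline : ∀ s t : V, s ∈ Loc q₀ → t ∈ Loc q₀ → s ∉ A₀ → t ∉ A₀ → s - t ∈ A₀

with `Loc q₀` = the Kummer (Selmer) condition at `q₀` and `A₀ = ker res_{q₀}`.  This file proves it in TREE currency from the single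
local count `#E(K_v)[2] = 2`:

* §1 `eq_of_mem_of_card_eq_two` — in a subgroup of order `2` two non-zero elements are equal (fact-free);
* §2 `sub_mem_torsionLocalKer_of_card_torsion_eq_two` — any number field `K`, `v ∤ 2` finite with `#E(K_v)[2] = 2`: two classes of
  `H¹(K, E[2])` in the Selmer condition at `v` (`selmerLocalKer`) with non-zero localisations at `v` differ by a class in the strict
  condition (`torsionLocalKer`) — the Kummer image `𝓛_v` has order `#E(K_v)[2]·#(𝓞_v/2) = 2` (Milne I Lemma 3.3,
  `natCard_kummerLocalConditionAt_adicCompletion`, PROVED in the tree), Selmer classes localise into it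
  (`mem_kummerLocalConditionAt_res_of_mem_selmerLocalKer`), and `res_v` is additive;
* §3 `hline_at_of_card` — over `ℚ` at an odd prime `q₀` below `v₀` with `#E(ℚ_{v₀})[2] = 2`: the engine's `hline` verbatim
  (`Loc q₀ = selmerLocalKer`, `A₀ = torsionLocalKer` at `v₀`).  At the transposition prime of a minimal door `#E(ℚ_{q₀})[2] = #Ẽ(𝔽_{q₀})[2] = 2`
  (`(Δ_min/q₀) = −1`); the same count holds for the twin `E^{(d_K)}` (`E^{(d)}[2] ≅ E[2]` over `ℚ`), so §2 serves `hline'` too once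
  the twin's classes are read in its own `H¹(ℚ, E^{(d)}[2])`.

References: [MazurRubin2010] Lemma 2.2 (i), Def. 3.1; [MilneADT2006] I Lemma 3.3; [GrossLMS1991] Prop. 2.3, §10; [Kramer1981] Prop. 3.
-/

set_option autoImplicit false
-- the Theorems namespace of this sub repeats the summit name by design (D-0017 nested layout)
set_option linter.dupNamespace false

noncomputable section

open scoped Classical Pointwise

universe u

namespace Summit.BirchSwinnertonDyer.BirchSwinnertonDyer.Theorems.RankOneAtTwoOneDoor

open WeierstrassCurve NumberField IsDedekindDomain Field
open Literature.NumberTheory.EllipticCurves Literature.NumberTheory.GaloisRepresentations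
open Literature.NumberTheory.GaloisCohomology
open Summit.BirchSwinnertonDyer.BirchSwinnertonDyer.Theorems.GenusExact
open Summit.BirchSwinnertonDyer.BirchSwinnertonDyer.Theorems.GenusExact.FrobeniusCriterion

/-! ## §1 Two non-zero elements of a subgroup of order `2` coincide -/

/-- **Fact-free**: in an additive subgroup `U` with `Nat.card U = 2`, two non-zero elements are equal (`U = {0, x}`). [folklore] -/
theorem eq_of_mem_of_card_eq_two {H : Type*} [AddCommGroup H] (U : AddSubgroup H) (hU : Nat.card U = 2) {x y : H}
    (hx : x ∈ U) (hy : y ∈ U) (hx0 : x ≠ 0) (hy0 : y ≠ 0) : x = y := by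
  by_contra hxy
  haveI : Finite U := Nat.finite_of_card_ne_zero (by rw [hU]; decide)
  letI : Fintype U := Fintype.ofFinite U
  -- the three distinct elements `0, x, y` of `U`
  have h3 : 3 ≤ Nat.card U := by
    have hsub : ({⟨0, U.zero_mem⟩, ⟨x, hx⟩, ⟨y, hy⟩} : Finset U).card = 3 := by
      rw [Finset.card_insert_of_notMem, Finset.card_pair]
      · exact fun h => hxy (congrArg Subtype.val h)
      · simp only [Finset.mem_insert, Finset.mem_singleton, not_or]
        exact ⟨fun h => hx0 (congrArg Subtype.val h).symm, fun h => hy0 (congrArg Subtype.val h).symm⟩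
    rw [← hsub, Nat.card_eq_fintype_card]
    exact Finset.card_le_univ _
  omega

/-! ## §2 At a place with `#E(K_v)[2] = 2` two Selmer classes alive at `v` differ by a class dead at `v` -/

section Local

variable {K : Type u} [Field K] [NumberField K] (W : WeierstrassCurve K) [W.IsElliptic]

/-- **The one-line leaf (Mazur–Rubin 2010 Lemma 2.2 (i)) from the local count.**  `E = W/K` elliptic, `v ∤ 2` a finite place with
`#E(K_v)[2] = 2`; `s, t ∈ H¹(K, E[2])` both in the Selmer (Kummer) condition at `v` and both with NON-ZERO localisation at `v`.  THEN
`s − t` has zero localisation at `v` (`s − t ∈ torsionLocalKer_v`).  Proof: the Kummer image `𝓛_v ⊆ H¹(K_v, E[2])` has order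
`#E(K_v)[2]·#(𝓞_v/2) = 2·1` (Milne I Lemma 3.3, tree theorem), contains `s_v`, `t_v ≠ 0`, so `s_v = t_v`.
[cite: MazurRubin2010, Lemma 2.2 (i)] [cite: MilneADT2006, Ch. I Lemma 3.3] -/
theorem sub_mem_torsionLocalKer_of_card_torsion_eq_two (v : HeightOneSpectrum (𝓞 K)) (h2v : ((2 : ℕ) : 𝓞 K) ∉ v.asIdeal)
    (hcard : Nat.card (nsmulAddMonoidHom 2 : (W.baseChange (v.adicCompletion K)).toAffine.Point →+ _).ker = 2)
    {s t : galH1Torsion W ((2 : ℕ) : ℤ)}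
    (hs : s ∈ selmerLocalKer W (v.adicCompletion K) ((2 : ℕ) : ℤ)) (ht : t ∈ selmerLocalKer W (v.adicCompletion K) ((2 : ℕ) : ℤ))
    (hs0 : s ∉ W.torsionLocalKer (v.adicCompletion K) ((2 : ℕ) : ℤ))
    (ht0 : t ∉ W.torsionLocalKer (v.adicCompletion K) ((2 : ℕ) : ℤ)) :
    s - t ∈ W.torsionLocalKer (v.adicCompletion K) ((2 : ℕ) : ℤ) := by
  haveI hK0 : CharZero (v.adicCompletion K) := charZero_adicCompletion v
  -- local objects at `v`
  set loc := galoisCohomology.localization (W.torsionGaloisModule ((2 : ℕ) : ℤ)) (Sum.inr v) 1 with hloc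
  set U := W.kummerLocalConditionAt ((2 : ℕ) : ℤ) (v.adicCompletion K) with hU
  -- `#U = 2`
  have hUcard : Nat.card U = 2 := by
    rw [hU, W.natCard_kummerLocalConditionAt_adicCompletion v two_ne_zero,
      LocalDualityOrder.natCard_quotient_span_natCast_eq_one v h2v, mul_one, hcard]
  -- `s_v, t_v ∈ U`, both non-zero
  have hx : loc s ∈ U := mem_kummerLocalConditionAt_res_of_mem_selmerLocalKer W _ _ hs
  have hy : loc t ∈ U := mem_kummerLocalConditionAt_res_of_mem_selmerLocalKer W _ _ ht
  have hx0 : loc s ≠ 0 := fun h => hs0 ((mem_torsionLocalKer_iff_res_eq_zero W (v.adicCompletion K) two_ne_zero s).mpr h)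
  have hy0 : loc t ≠ 0 := fun h => ht0 ((mem_torsionLocalKer_iff_res_eq_zero W (v.adicCompletion K) two_ne_zero t).mpr h)
  -- hence `s_v = t_v`, i.e. `(s - t)_v = 0`
  have hxy : loc s = loc t := eq_of_mem_of_card_eq_two U hUcard hx hy hx0 hy0
  have hst' : loc (s - t) = loc s - loc t := map_sub loc s t
  have hst : loc (s - t) = 0 := by rw [hst', hxy, sub_self]
  exact (mem_torsionLocalKer_iff_res_eq_zero W (v.adicCompletion K) two_ne_zero (s - t)).mpr hst

end Local

/-! ## §3 Over `ℚ`: the engine's `hline` at an odd place with `#E(ℚ_v)[2] = 2` -/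

section Rat

variable (W : WeierstrassCurve ℚ) [W.IsElliptic]

/-- **`hline` of `…OneDoorFirstDescentAtTwo.lean` AT THE ERROR PLACE, from the local count** (`Loc q₀ = selmerLocalKer` and
`A₀ = torsionLocalKer` at the place `v₀` of an odd prime `q₀` with `#E(ℚ_{v₀})[2] = 2` — at the transposition prime of a minimal door
`#E(ℚ_{q₀})[2] = #Ẽ(𝔽_{q₀})[2] = 2`): two classes in the Selmer condition at `q₀` with non-zero localisations there differ by a class with
zero localisation. [cite: MazurRubin2010, Lemma 2.2 (i)] [cite: GrossLMS1991, Prop. 2.3 and §10] -/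
theorem hline_at_of_card {q₀ : ℕ} [Fact q₀.Prime] (hq₀2 : q₀ ≠ 2) {v₀ : HeightOneSpectrum (𝓞 ℚ)} (hq₀v : (q₀ : 𝓞 ℚ) ∈ v₀.asIdeal)
    (hcard : Nat.card (nsmulAddMonoidHom 2 : (W.baseChange (v₀.adicCompletion ℚ)).toAffine.Point →+ _).ker = 2) :
    ∀ s t : galH1Torsion W ((2 : ℕ) : ℤ),
      s ∈ selmerLocalKer W (v₀.adicCompletion ℚ) ((2 : ℕ) : ℤ) → t ∈ selmerLocalKer W (v₀.adicCompletion ℚ) ((2 : ℕ) : ℤ) →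
      s ∉ W.torsionLocalKer (v₀.adicCompletion ℚ) ((2 : ℕ) : ℤ) → t ∉ W.torsionLocalKer (v₀.adicCompletion ℚ) ((2 : ℕ) : ℤ) →
      s - t ∈ W.torsionLocalKer (v₀.adicCompletion ℚ) ((2 : ℕ) : ℤ) :=
  fun _ _ hs ht hs0 ht0 =>
    sub_mem_torsionLocalKer_of_card_torsion_eq_two W v₀ (LocalDualityOrder.two_notMem_of_odd_prime_mem hq₀2 hq₀v) hcard hs ht hs0 ht0

end Rat

end Summit.BirchSwinnertonDyer.BirchSwinnertonDyer.Theorems.RankOneAtTwoOneDoor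

end
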